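import Summits.Ventures.CertifiedArithmetic.LowPrec.GemmTieChains
import Summits.Ventures.CertifiedArithmetic.LowPrec.JRBridge

/-!
# E2M1² → bfloat16, sequential RNE, LOW trajectories (I): letters and quarter-integer roundings

HONEST FRAMING (venture CertifiedArithmetic / cell `pub-lowprec`): certified error envelopes and
provably optimal rounding/accumulation schemes for low-precision formats under stated cost models;
every table by two implementations; no hardware or vendor claims.

Toolkit for gemm.tex Lemma `l:low` (the theorem itself is `GemmLowTrajectoriesBound.lean`).
Setting of `GemmTieChains.lean` / `paper/gemm.tex` Prop. `p:sandwich`: letters `pᵢ ∈ Π(E2M1,E2M1)`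
(`piE2M1`, 37 values in `¼ℤ ∩ [-36,36]`), accumulated sequentially in `bfloat16` under the cell's
saturating round-to-nearest-even (`seqSum`). Proved here:
(1) letters (kernel checks over the 37 values): `Π ⊂ ¼ℤ`, `|p| ≤ 36`, `p ≠ 0 ⇒ |p| ≥ ¼`,
`2p ∉ ℤ ⇒ |p| ≤ 9/4`, `|p| > 24 ⇒ |p| = 36`; and the FIRST-ENTRY MASS lemma
`mass_three_of_entry` (`|p₀+p₁+p₂| ≥ 64`, `2(p₀+p₁+p₂) ∉ ℤ` ⇒ `|p₀|+|p₁|+|p₂| ≥ 72¼`);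
(2) bfloat16 (= `F(8, -133)` in range, via `JRBridge`): `¼ℤ ∩ (-64,64)` and `½ℤ ∩ [-128,128]`
are values, values of modulus `≥ 32` lie in `¼ℤ`;
(3) `roundNE_quarter`: for `X ∈ ¼ℤ`, `|X| < 128`: `|fl(X) - X| ≤ ¼`, `fl(X) ∈ ¼ℤ`, `|fl(X)| ≤ 128`,
and an INEXACT rounding forces `|X| ≥ 64¼` with `4X` odd.
-/

namespace Literature.ComputerArithmetic.FloatingPoint

namespace MiniFloat

open Finset Format
open Literature.ComputerArithmetic.JeannerodRump2018

/-! ### The letters of `Π(E2M1,E2M1)` -/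

/-- Every letter is a quarter-integer. [cell, gemm.tex Lemma l:low] -/
theorem exists_eq_div_four_of_mem_piE2M1 : ∀ p ∈ piE2M1, ∃ z : ℤ, p = (z : ℚ) / 4 := by
  have h : (piE2M1.all fun p => decide (((4 * p).num : ℚ) = 4 * p)) = true := by decide +kernel
  intro p hp
  have h1 := of_decide_eq_true (List.all_eq_true.mp h p hp)
  exact ⟨(4 * p).num, by rw [h1]; ring⟩

/-- Letter facts: `|p| ≤ 36`; `p ≠ 0 ⇒ ¼ ≤ |p|`; `2p ∉ ℤ ⇒ |p| ≤ 9/4`; `24 < |p| ⇒ |p| = 36`.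
[cell, gemm.tex Lemma l:low] -/
theorem letter_facts : ∀ p ∈ piE2M1,
    |p| ≤ 36 ∧ (p ≠ 0 → 1 / 4 ≤ |p|) ∧ ((¬ ∃ w : ℤ, p = (w : ℚ) / 2) → |p| ≤ 9 / 4) ∧
      (24 < |p| → |p| = 36) := by
  have h : (piE2M1.all fun p => decide (|p| ≤ 36 ∧ (p ≠ 0 → 1 / 4 ≤ |p|) ∧
      ((((2 * p).num : ℚ) ≠ 2 * p) → |p| ≤ 9 / 4) ∧ (24 < |p| → |p| = 36))) = true := by
    decide +kernel
  intro p hp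
  obtain ⟨h1, h2, h3, h4⟩ := of_decide_eq_true (List.all_eq_true.mp h p hp)
  refine ⟨h1, h2, fun hn => h3 (fun heq => hn ⟨(2 * p).num, by rw [heq]; ring⟩), h4⟩

/-- THE FIRST-ENTRY MASS AT STEP 2: if `p₀ + p₁ + p₂` is not a half-integer and has modulus `≥ 64`
then `|p₀| + |p₁| + |p₂| ≥ 72¼` (one letter is a quarter-letter of modulus `≤ 9/4`, the other two
must be `±36`). [cell, gemm.tex Lemma l:low (b)] -/
theorem mass_three_of_entry {a b c : ℚ} (ha : a ∈ piE2M1) (hb : b ∈ piE2M1) (hc : c ∈ piE2M1)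
    (hbig : 64 ≤ |a + b + c|) (hnh : ¬ ∃ w : ℤ, a + b + c = (w : ℚ) / 2) :
    289 / 4 ≤ |a| + |b| + |c| := by
  obtain ⟨ha1, ha2, ha3, ha4⟩ := letter_facts a ha
  obtain ⟨hb1, hb2, hb3, hb4⟩ := letter_facts b hb
  obtain ⟨hc1, hc2, hc3, hc4⟩ := letter_facts c hc
  -- one of the three is not a half-integer
  have key : ∀ {f g h : ℚ}, |f| ≤ 36 → |g| ≤ 36 → (24 < |f| → |f| = 36) → (24 < |g| → |g| = 36) →
      (h ≠ 0 → 1 / 4 ≤ |h|) → |h| ≤ 9 / 4 → (¬ ∃ w : ℤ, h = (w : ℚ) / 2) → 64 ≤ |f + g + h| →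
      289 / 4 ≤ |f| + |g| + |h| := by
    intro f g h hf hg hf24 hg24 hh0 hh9 hhn hsum
    have hfg : 247 / 4 ≤ |f| + |g| := by
      have := abs_add_le (f + g) h
      have := abs_add_le f g
      linarith
    have hf36 : |f| = 36 := hf24 (by linarith)
    have hg36 : |g| = 36 := hg24 (by linarith)
    have hhne : h ≠ 0 := by rintro rfl; exact hhn ⟨0, by simp⟩
    have := hh0 hhne
    linarith
  by_cases hA : ∃ w : ℤ, a = (w : ℚ) / 2
  · by_cases hB : ∃ w : ℤ, b = (w : ℚ) / 2
    · have hC : ¬ ∃ w : ℤ, c = (w : ℚ) / 2 := by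
        rintro ⟨wc, hwc⟩
        obtain ⟨wa, hwa⟩ := hA; obtain ⟨wb, hwb⟩ := hB
        exact hnh ⟨wa + wb + wc, by rw [hwa, hwb, hwc]; push_cast; ring⟩
      exact key ha1 hb1 ha4 hb4 hc2 (hc3 hC) hC hbig
    · have := key ha1 hc1 ha4 hc4 hb2 (hb3 hB) hB (by rwa [show a + c + b = a + b + c by ring])
      linarith
  · have := key hb1 hc1 hb4 hc4 ha2 (ha3 hA) hA (by rwa [show b + c + a = a + b + c by ring])
    linarith

/-! ### `bfloat16` structure: quarter- and half-integers -/

/-- `bfloat16` has `8` significand bits and quantum exponent `-133`. [BHLMP2020, Table 1.1] -/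
theorem BFloat16_params : Format.BFloat16.manBits + 1 = 8 ∧ Format.BFloat16.qexp = -133 := by
  decide

/-- `128 ≤ maxRat(bfloat16)`. [folklore] -/
theorem BFloat16_maxRat_ge : (128 : ℚ) ≤ Format.BFloat16.maxRat := by decide +kernel

/-- A quarter-integer `z/4` with `|z| < 256` (modulus `< 64`) is a `bfloat16` value. [folklore] -/
theorem exists_bf16_eq_quarter_of_abs_lt {z : ℤ} (hz : |z| < 256) :
    ∃ y : MiniFloat Format.BFloat16, y.toRat = (z : ℚ) / 4 := by
  refine exists_toRat_eq_of_isFloat ⟨z, -2, ?_, by rw [BFloat16_params.2]; norm_num, ?_⟩ ?_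
  · rw [BFloat16_params.1]; exact_mod_cast hz
  · rw [zpow_neg, show ((2:ℚ) ^ (2:ℤ)) = 4 by norm_num]; ring
  · have : |(z : ℚ)| < 256 := by exact_mod_cast hz
    rw [abs_div, abs_of_pos (by norm_num : (0:ℚ) < 4)]
    linarith [BFloat16_maxRat_ge]

/-- A half-integer `w/2` with `|w| ≤ 256` (modulus `≤ 128`) is a `bfloat16` value. [folklore] -/
theorem exists_bf16_eq_half_of_abs_le {w : ℤ} (hw : |w| ≤ 256) :
    ∃ y : MiniFloat Format.BFloat16, y.toRat = (w : ℚ) / 2 := by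
  have hmax : |(w : ℚ) / 2| ≤ Format.BFloat16.maxRat := by
    have : |(w : ℚ)| ≤ 256 := by exact_mod_cast hw
    rw [abs_div, abs_of_pos (by norm_num : (0:ℚ) < 2)]
    linarith [BFloat16_maxRat_ge]
  rcases lt_or_eq_of_le hw with hlt | heq
  · refine exists_toRat_eq_of_isFloat ⟨w, -1, ?_, by rw [BFloat16_params.2]; norm_num, ?_⟩ hmax
    · rw [BFloat16_params.1]; exact_mod_cast hlt
    · rw [zpow_neg, zpow_one]; ring
  · -- `|w| = 256`: `±128 = ±2^7`
    rcases abs_eq (by norm_num : (0:ℤ) ≤ 256) |>.mp heq with h | h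
    · refine exists_toRat_eq_of_isFloat ⟨1, 7, ?_, by rw [BFloat16_params.2]; norm_num, ?_⟩ hmax
      · rw [BFloat16_params.1]; norm_num
      · rw [h]; norm_num
    · refine exists_toRat_eq_of_isFloat ⟨-1, 7, ?_, by rw [BFloat16_params.2]; norm_num, ?_⟩ hmax
      · rw [BFloat16_params.1]; norm_num
      · rw [h]; norm_num

/-- A `bfloat16` value of modulus `≥ 32` is a quarter-integer. [folklore] -/
theorem exists_eq_div_four_of_bf16_ge_32 (y : MiniFloat Format.BFloat16) (hy : 32 ≤ |y.toRat|) :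
    ∃ z : ℤ, y.toRat = (z : ℚ) / 4 := by
  obtain ⟨M, e, hM, he, hval⟩ := isFloat_toRat y
  rw [BFloat16_params.1] at hM
  have hM' : |(M : ℚ)| ≤ 255 := by
    have : |M| ≤ 255 := by omega
    exact_mod_cast this
  -- `e ≥ -2`: otherwise `|M| 2^e ≤ 255/8 < 32`
  have he2 : -2 ≤ e := by
    by_contra hlt
    have hlt : e ≤ -3 := by omega
    have hpow : (2:ℚ) ^ e ≤ (2:ℚ) ^ (-3:ℤ) := zpow_le_zpow_right₀ (by norm_num) hlt
    rw [hval, abs_mul, abs_of_pos (zpow_pos (by norm_num : (0:ℚ) < 2) e)] at hy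
    have : |(M:ℚ)| * (2:ℚ) ^ e ≤ 255 * (2:ℚ) ^ (-3:ℤ) :=
      mul_le_mul hM' hpow (zpow_pos (by norm_num) e).le (by norm_num)
    norm_num at this
    linarith
  obtain ⟨d, hd⟩ := Int.eq_ofNat_of_zero_le (show 0 ≤ e + 2 by omega)
  refine ⟨M * 2 ^ d, ?_⟩
  rw [hval, show e = (d : ℤ) + (-2 : ℤ) by omega, zpow_add₀ (by norm_num : (2:ℚ) ≠ 0), zpow_natCast]
  push_cast
  rw [zpow_neg, show ((2:ℚ) ^ (2:ℤ)) = 4 by norm_num]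
  ring

/-! ### One rounding of a quarter-integer of modulus `< 128` in `bfloat16` -/

/-- For `X = z/4` with `|z| < 512`: (i) `|fl(X) - X| ≤ ¼`; (ii) `fl(X) ∈ ¼ℤ` and `|fl(X)| ≤ 128`;
(iii) if the rounding is inexact then `|z| ≥ 257` and `z` is odd. [cell, gemm.tex Lemma l:low] -/
theorem roundNE_quarter {z : ℤ} (hz : |z| < 512) :
    |(roundNE Format.BFloat16 ((z:ℚ) / 4)).toRat - (z:ℚ) / 4| ≤ 1 / 4 ∧
    (∃ z' : ℤ, (roundNE Format.BFloat16 ((z:ℚ) / 4)).toRat = (z' : ℚ) / 4) ∧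
    |(roundNE Format.BFloat16 ((z:ℚ) / 4)).toRat| ≤ 128 ∧
    ((roundNE Format.BFloat16 ((z:ℚ) / 4)).toRat ≠ (z:ℚ) / 4 → 257 ≤ |z| ∧ ¬ 2 ∣ z) := by
  set X : ℚ := (z : ℚ) / 4 with hX
  have hzq : |(z:ℚ)| < 512 := by exact_mod_cast hz
  -- exactness below 64 and on half-integers
  have hexact_small : |z| < 256 → (roundNE Format.BFloat16 X).toRat = X := fun h =>
    toRat_roundNE_of_exists (exists_bf16_eq_quarter_of_abs_lt h)
  have hexact_even : 2 ∣ z → (roundNE Format.BFloat16 X).toRat = X := by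
    rintro ⟨w, rfl⟩
    have hzb := abs_lt.mp hz
    have hw : |w| ≤ 256 := abs_le.mpr ⟨by omega, by omega⟩
    have hXw : X = (w : ℚ) / 2 := by rw [hX]; push_cast; ring
    rw [hXw]; exact toRat_roundNE_of_exists (exists_bf16_eq_half_of_abs_le hw)
  -- the general error bound `¼` via the half-integer neighbours `(z ± 1)/4`
  have herr : |(roundNE Format.BFloat16 X).toRat - X| ≤ 1 / 4 := by
    by_cases h2 : 2 ∣ z
    · rw [hexact_even h2, sub_self, abs_zero]; norm_num
    · -- `z` odd: `(z+1)/4 = ((z+1)/2)/2` is a value at distance `¼`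
      obtain ⟨w, hw⟩ : ∃ w : ℤ, z + 1 = 2 * w := by
        rcases Int.even_or_odd z with ⟨r, hr⟩ | ⟨r, hr⟩
        · exact absurd ⟨r, by omega⟩ h2
        · exact ⟨r + 1, by omega⟩
      have hzb := abs_lt.mp hz
      have hwb : |w| ≤ 256 := abs_le.mpr ⟨by omega, by omega⟩
      obtain ⟨y, hy⟩ := exists_bf16_eq_half_of_abs_le hwb
      have h1 := roundNE_nearest (φ := Format.BFloat16) X y
      have hdist : |X - y.toRat| = 1 / 4 := by
        rw [hy, hX, show (z:ℚ) / 4 - (w:ℚ) / 2 = ((z:ℚ) - 2 * w) / 4 by ring,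
          show (z:ℚ) - 2 * (w:ℚ) = -1 by
            have : ((z + 1 : ℤ) : ℚ) = ((2 * w : ℤ) : ℚ) := by rw [hw]
            push_cast at this; linarith]
        norm_num
      rw [abs_sub_comm]; linarith
  have habsX : |X| < 128 := by
    rw [hX, abs_div, abs_of_pos (by norm_num : (0:ℚ) < 4)]; linarith
  have hval_le : |(roundNE Format.BFloat16 X).toRat| ≤ 128 := by
    -- `|X| ≤ 127¾` (a quarter-integer below 128) and the error is at most `¼`
    have hz' : |z| ≤ 511 := by omega
    have : |X| ≤ 511 / 4 := by
      rw [hX, abs_div, abs_of_pos (by norm_num : (0:ℚ) < 4)]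
      have : |(z:ℚ)| ≤ 511 := by exact_mod_cast hz'
      linarith
    have h3 := abs_le.mp herr
    have h4 := abs_le.mp this
    rw [abs_le]; constructor <;> linarith
  refine ⟨herr, ?_, hval_le, fun hne => ?_⟩
  · -- the result is a quarter-integer
    by_cases hsmall : |z| < 256
    · exact ⟨z, hexact_small hsmall⟩
    · apply exists_eq_div_four_of_bf16_ge_32
      have hXge : 64 ≤ |X| := by
        rw [hX, abs_div, abs_of_pos (by norm_num : (0:ℚ) < 4)]
        have : (256:ℚ) ≤ |(z:ℚ)| := by exact_mod_cast not_lt.mp hsmall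
        linarith
      have h3 := abs_le.mp herr
      have := abs_sub_abs_le_abs_sub X (roundNE Format.BFloat16 X).toRat
      rw [abs_sub_comm] at this
      linarith
  · constructor
    · by_contra hlt
      have hlt : |z| ≤ 256 := by omega
      rcases lt_or_eq_of_le hlt with h | h
      · exact hne (hexact_small h)
      · -- `|z| = 256` is even
        exact hne (hexact_even (by
          rcases (abs_eq (by norm_num : (0:ℤ) ≤ 256)).mp h with h' | h'
          · exact ⟨128, by rw [h']; norm_num⟩
          · exact ⟨-128, by rw [h']; norm_num⟩))
    · exact fun h2 => hne (hexact_even h2)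

end MiniFloat

end Literature.ComputerArithmetic.FloatingPoint
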